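import Summits.QuantumFields.YangMills.Theorems.BalabanUVNodesN11SpaceTruncationSameWitnessFibre
import Summits.QuantumFields.YangMills.Theorems.BalabanUVNodesN11NoExpansionTStepZhPinOfSolvable

/-!
# DAG node N11 — ★★★★★ THE SAME-WITNESS NO-EXPANSION 𝐓-STEP (the clause for the GIVEN §2 witness) IN THE ZhPin CLASS FROM K0's ROWS (levels `1…k+1`) AND THE
# STRUCTURAL ROWS ALONE — 12a″'s `RegOn` at parents AND children and def-R's `BgProvisoΛ` over BOTH charged supports DISCHARGED (conclusion VERBATIM p598184 (γ′))

HEADER — WORK-UNIT METADATA.  Cell `pub-ymgap`, YM-PLAN Track A (HUMAN RULING D-0062), seat `pub-ymgap-dag-n11-d` (g13; R134 fan-out seat N11 [B14], strategy s2),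
route `BalabanUVNodes`, item K1⁷ `StabilityBAtRecordR13SepCoPH` = stmt-QuantumFields-20542 (helper, `--kind proof --supports 20542 --as helper`, count-neutral).
[III] = [Balaban1988Convergent], [15] = [Balaban1985Variational], [B7] = [Balaban1985Averaging], [6] = [Balaban1985RegularSpaces], [LF-I] = [Balaban1989LargeFieldI].  Over g13's
`…N11SpaceTruncationSameWitnessFibre` ((γ′) on the fibres), `…N11NoExpansionTStepZhPinOfSolvable` (`regOn_cutSel_of_zhPin_of_solvable`), `…N11ChargedSepJunctionFibre`
(`bgProvisoΛ_chargedFibre_of_sep_of_junctionFibre`), `…N11ChargedSepJunctionOfSolvableFibre` (`sepJunctionChargedFibre_of_solvable`), `…N11Data7OnFibre`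
(`dataSmall7PTop_of_read_of_top_of_fibre`), `…N11ReadRegRePinned` (`sep_setOf_eq_of`), g12's `…N11ChiTopRegularity` (★★★★), dag-n11-e g6's `B14SeparationOfRecord`
(`separated_of_slotsTOfRecord₁₃_succ_ne_zero`, `seqSeparated_of_hullD`, `gridClause_of_M₁_le_M`), dag-n11-w1's `…GaussianCertificateRows` (`zhUnity_of_gaussCert`).

WHY THIS FILE.  dag-n11-w1's THEOREM 1 along the witness chain (`…Sect3SupplyChainBorelBObligations`, at `gaussPinH θ`) displays, besides K0's rows and the supplier, the
reading-line primitives: 12a″'s `RegOn` at parents and children and def-R's `BgProvisoΛ` over the charged reading supports at levels `k` and `k+1`.  In the ZhPin class all four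
are THEOREMS from K0's per-cube [15]-solvability + cube cover + numerics (levels `1…k+1`) and the record row `Provisos₁₃SepCoPH.bg` (levels `k`, `k+1`), by g13's iterated-fibre
chain: this file delivers p598184's (γ′) with exactly those rows — after it THEOREM 1 along the chain needs no reading-line primitive beyond K0's rows, the windows and `PartCompat₁₃`.

WHAT THIS FILE PROVES (0 `sorry`, 0 `def`).  §1 `seqSeparated_of_slotsTOfRecord₁₃_succ_ne_zero_of_M₁_le_M` (a child charged by its 𝐓-slot is separated); `mem_suppOfRecord₁₃SepCoP_of_sep_of_top_of_fibre`
(the charge-free fibre junction).  §2 ★★★★★ `clause_succ_sameWitness_of_hasSect2FormAtZS_of_borelB_of_zhPin_of_solvable`.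

HONEST FRAMING.  Helper lane of K1⁷; composition; nothing of [III] ∕ [15] ∕ [B7] asserted (solvability, cover, numerics, `Provisos₁₃SepCoPH` are HYPOTHESES — K0 ∕ def-R ∕ plan
rows; K0a's `cR := 1`, `M = M₂ = 1` meet NEITHER `2 ≤ cR` NOR the cover, located g12).  The binders INSIDE the conclusion are untouched.  N11 NOT discharged; K1⁷ NOT closed;
counts unmoved (typed 28∕28 · discharged 5∕27).  One finite four-torus programme at fixed `ε = L^{−K}` — NOT ℝ⁴, NOT OS, NOT a mass gap, NOT Clay.  No `sorry`, `axiom`, `def`,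
`instance`, `notation`.  Sources (SHAPE only): [III] Theorem p.245, (2.1)–(2.2) pp.254–255, (2.7) p.255, (2.10) p.256, (2.16)–(2.18) p.257, (2.20)–(2.28) pp.258–259, (2.41)–(2.42)
p.261, (3.5) p.265, (3.16) p.268, (3.24)–(3.25) p.270; [15] Thm 1 (7)–(8) pp.278–279; [B7] Prop. 2 p.26; [6] (1.3)–(1.6) p.77; [LF-I] (0.2)–(0.3) p.176.
-/

noncomputable section

open MeasureTheory
open scoped BigOperators ENNReal NNReal Matrix.Norms.L2Operator

namespace Summit.QuantumFields.YangMills.Theorems.BalabanUVNodesN11SameWitnessZhPinOfSolvable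

open Literature.MathematicalPhysics.QuantumFieldTheory.Balaban1983to89 T4Continuum T4NestedCovariance Node00 Node00.Tk DagBinding
open B15DeterminingSets B8Eq17ClassAkV1 B14.Eq218Concrete B10Eq42TorusConstraint
open B14.Eq213MaximalDomains (side)
open B14.Eq213DetSet (Bj)
open Literature.MathematicalPhysics.QuantumFieldTheory.BalabanImbrieJaffe1984to88.BIJ85Eq453GaugeField (qsstarGIter0)
open BalabanUVNodesN11FluctTruncationDefs (IsFluctLocal)
open BalabanUVNodesN11SpaceTruncationDefs BalabanUVNodesN11SpaceTruncationBorelBDefs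
open BalabanUVNodesN11HistoryPinnedResidualDefs BalabanUVNodesN11RePinnedParamDefs
open B14SeparationOfRecord (separated_of_slotsTOfRecord₁₃_succ_ne_zero seqSeparated_of_hullD gridClause_of_M₁_le_M)
open BalabanUVNodesN11ChiTopRegularity (plaqSmallOn_genSet_top_of_chiSeqOfRecord_ne_zero_of_solvable)
open BalabanUVNodesN11Data7OnFibre (dataSmall7PTop_of_read_of_top_of_fibre)
open BalabanUVNodesN11ChargedSepJunctionFibre (bgProvisoΛ_chargedFibre_of_sep_of_junctionFibre)
open BalabanUVNodesN11ChargedSepJunctionOfSolvableFibre (sepJunctionChargedFibre_of_solvable)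
open BalabanUVNodesN11ReadRegRePinned (sep_setOf_eq_of)
open BalabanUVNodesN11NoExpansionTStepZhPinOfSolvable (regOn_cutSel_of_zhPin_of_solvable)
open BalabanUVNodesN11SpaceTruncationSameWitnessFibre (clause_succ_sameWitness_of_hasSect2FormAtZS_of_borelB_of_bgReadChargedFibre)
open BalabanUVNodesN11GaussianCertificateRows (zhUnity_of_gaussCert)

variable {F : T4Family} {N : ℕ} [NeZero N]

variable (θ : Stage13HParams F N) (p : B12.RunParams)

/-! ## §1  A child charged by its 𝐓-slot is separated; the charge-free fibre junction -/

/-- **A SEQUENCE CHARGED BY A PRE-𝐑 SLOT `slotT_{k+1}` OF THE RECORD IS PRINT-SEPARATED** (`0 < M₁ ≤ M`) — the 𝐓-slot twin of dag-n11-e g6's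
`seqSeparated_of_slotsOfRecord₁₃_ne_zero_of_M₁_le_M` (three 𝐃-layers `separated_of_slotsTOfRecord₁₃_succ_ne_zero` + `seqSeparated_of_hullD` + `gridClause_of_M₁_le_M`).
[cite: Balaban1988Convergent, (2.1) p.254, p.256, (3.5) p.265, (3.24)–(3.25) p.270; Balaban1985RegularSpaces, (1.3)–(1.6) p.77] -/
theorem seqSeparated_of_slotsTOfRecord₁₃_succ_ne_zero_of_M₁_le_M (hM₁ : 0 < θ.ν.M₁) (hle : θ.ν.M₁ ≤ θ.τ9.M) {k : ℕ}
    (s' : SeqOfRecord F θ.ν θ.τ9.M (gOfRecord₁₃ F N θ.toStage13Params p) p.K (k + 1))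
    (hs' : slotsTOfRecord F N θ.ν θ.τ9 (EOfRecord₁₃ F N θ.toStage13Params) (wOfRecord₉ F N θ.toStage9Params) θ.ppSel p
      (gOfRecord₁₃ F N θ.toStage13Params p) (k + 1) s' ≠ 0) :
    Sect2.SeqSeparated θ.ν.M₁ s' :=
  seqSeparated_of_hullD F θ.ν θ.τ9 p (gOfRecord₁₃ F N θ.toStage13Params p) s'
    (fun j _ _ => gridClause_of_M₁_le_M F θ.ν θ.τ9 p (gOfRecord₁₃ F N θ.toStage13Params p) j hM₁ hle)
    (separated_of_slotsTOfRecord₁₃_succ_ne_zero (F := F) (N := N) (θ := θ.toStage13Params) (p := p) k s' hs')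

/-- **THE CHARGE-FREE FIBRE JUNCTION** (`1 ≤ n`, `1 ≤ M₁`): a SEPARATED index `s`, a configuration `Wc` with the reading support's lower-scale clauses, the TOP clause
`PlaqSmallOn (plaqsOf (genSet s.Ω n n)) (cR·ε_n) (Wc n)` and the fibre identity lies in def-T's separated (7)-regular support — `…N11Data7OnFibre.sepJunctionChargedFibre_of_top`
without the charge premise (which it only threaded). [cite: Balaban1988Convergent, (2.2) p.255, (2.10) p.256, (2.28) p.259; Balaban1985Variational, (7) p.278; Balaban1985RegularSpaces, (1.3)–(1.6) p.77] -/
theorem mem_suppOfRecord₁₃SepCoP_of_sep_of_top_of_fibre {n : ℕ} (hn : 1 ≤ n) (hM₁ : 1 ≤ θ.ν.M₁)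
    (s : SeqOfRecord F θ.ν θ.τ9.M (gOfRecord₁₃ F N θ.toStage13Params p) p.K n) (hs : Sect2.SeqSeparated θ.ν.M₁ s) (Wc : MSField (F.P p.K) (SU N))
    (hlow : ∀ j, j < n → PlaqSmallOn (plaqsOf (pts j (readSelOfSeq F p (suppDomOfRecord F θ.ν p.K s.Ω) s.Ω j (s.Ω (j + 1))ᶜ)))
      (θ.s2.cR * epsOfRecord θ.ν (gOfRecord₁₃ F N θ.toStage13Params p) j) (Wc j))
    (htop : PlaqSmallOn (plaqsOf (genSet s.Ω n n)) (θ.s2.cR * epsOfRecord θ.ν (gOfRecord₁₃ F N θ.toStage13Params p) n) (Wc n))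
    (hfib : ∀ j, j < n → ∀ b : PBond (F.P p.K) (j + 1), b ∈ bondsIn (j + 1) (s.Ω (j + 1))ᶜ → (avOfRecord F N p.K j).avg (Wc j) b = Wc (j + 1) b) :
    Wc ∈ suppOfRecord₁₃SepCoP F N θ.toStage13Params p n s := by
  refine (mem_suppOfRecord₁₃SepCoP_iff F N θ.toStage13Params p n s Wc).mpr ⟨⟨?_, fun j h1 hj => ?_⟩, hs,
    dataSmall7PTop_of_read_of_top_of_fibre F N θ.ν hM₁ p hn s hs _ Wc hlow htop hfib⟩
  · have h0 := hlow 0 hn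
    rw [readSelOfSeq_zero_compl, pts_zero] at h0
    exact h0
  · rcases Nat.lt_or_eq_of_le hj with hlt | rfl
    · have h1' := hlow j hlt
      rw [readSelOfSeq_compl_eq_gammaRegion _ _ h1 hlt] at h1'
      exact h1'
    · exact htop

/-! ## §2  ★★★★★ The same-witness clause in the ZhPin class from K0's rows and the structural rows alone -/

/-- **★★★★★ (γ′) THE SAME-WITNESS NO-EXPANSION 𝐓-STEP CLAUSE IN THE ZhPin CLASS FROM K0's ROWS (levels `1…k+1`) AND THE STRUCTURAL ROWS ALONE — `ZhUnity`, 12a″'s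
`RegOn` AT PARENTS AND CHILDREN, AND def-R's `BgProvisoΛ` OVER BOTH CHARGED SUPPORTS ALL DISCHARGED** (θ GENERIC in the ZhPin class `hζ0`: `rePinH θ′`, dag-n11-w1's
`gaussPinH θ′`).  Conclusion VERBATIM p598184's (γ′) (the clause for the GIVEN witness `(t₀ (init s′), E₀ (init s′))` at every no-expansion child).  Rows: `Provisos₁₃SepCoPH θ`,
`Admissible`, `s2.Pos`, `0 < M₁ ≤ M`, `1 ≤ M`, the windows `InInterval θ.γ k`, `InInterval θ.γ (k+1)` and `PartCompat₁₃` at `k`, `k+1`, `1 ≤ k`, `k + 1 ≤ m + K`, `2 ≤ cR`, and PER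
LEVEL `1 ≤ j ≤ k+1`: K0's per-cube [15]-solvability inside `χ_j`, the cube cover of `Ω_j`, the numerics; the named witness `hform₀` with Borel 𝐁-terms `hBt` on `[1, k]`.
Mechanism: `…SameWitnessFibre`'s (γ′) with `hreg`∕`hreg′` := `regOn_cutSel_of_zhPin_of_solvable` at lengths `k`, `k+1`; `hbg` := record row `bg` at level `k` + the fibre
junction from solvability; `hbg′` := record row `bg` at level `k+1` (restricted to the domains of levels `≤ k`) + the CHARGE-FREE fibre junction at level `k+1`, the child being
separated because its 𝐓-slot is charged (`seqSeparated_of_slotsTOfRecord₁₃_succ_ne_zero_of_M₁_le_M`).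
[cite: Balaban1988Convergent, Theorem p.245, Thm 1 p.262, (2.1)–(2.2) pp.254–255, (2.7) p.255, (2.10) p.256, (2.16)–(2.18) p.257, (2.20)–(2.28) pp.258–259, (2.41)–(2.42) p.261, (3.5) p.265, (3.16) p.268, (3.24)–(3.25) p.270; Balaban1985Variational, Thm 1 (7)–(8) pp.278–279; Balaban1985Averaging, Prop. 2 p.26; Balaban1985RegularSpaces, (1.3)–(1.6) p.77; Balaban1989LargeFieldI, (0.2)–(0.3) p.176] -/
theorem clause_succ_sameWitness_of_hasSect2FormAtZS_of_borelB_of_zhPin_of_solvable (hζ0 : ∀ (p' : B12.RunParams) (n : ℕ) (Ω Λ : ℕ → Set (Site (F.P p'.K) 0)), (θ.Zh p' n Ω Λ).ζ0 = (ZhPinOfRecord₁₃ θ.toStage13Params p' Ω Λ).ζ0)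
    (h : θ.Provisos₁₃SepCoPH F N) (hθ : θ.Admissible F N)
    (hpos : θ.s2.Pos) (hM₁ : 0 < θ.ν.M₁) (hle : θ.ν.M₁ ≤ θ.τ9.M) {k : ℕ} (hk : k < p.K) (hM : 1 ≤ θ.τ9.M)
    (hw : Step.InInterval θ.γ k (gOfRecord₁₃ F N θ.toStage13Params p)) (hPC : PartCompat₁₃ F N θ.toStage13Params p k)
    (hw' : Step.InInterval θ.γ (k + 1) (gOfRecord₁₃ F N θ.toStage13Params p)) (hPC' : PartCompat₁₃ F N θ.toStage13Params p (k + 1))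
    (hk1 : 1 ≤ k) (hkm : k + 1 ≤ (F.P p.K).m + (F.P p.K).K) (hcR : 2 ≤ θ.s2.cR)
    (h3 : ∀ j, 1 ≤ j → j ≤ k + 1 →
      3 * side (F.P p.K).L θ.ν.M₁ j ≤ cubeSide (F.P p.K).L θ.ν.M₂ (RkOfRecord (F.P p.K).L θ.ν.r (gOfRecord₁₃ F N θ.toStage13Params p j)) j)
    (hR : ∀ j, 1 ≤ j → j ≤ k + 1 → (F.P p.K).L ^ j + (((F.P p.K).d + 4) * (F.P p.K).L + 2) * (∑ l ∈ Finset.range j, (F.P p.K).L ^ l) + 2 ≤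
      cubeSide (F.P p.K).L θ.ν.M₂ (RkOfRecord (F.P p.K).L θ.ν.r (gOfRecord₁₃ F N θ.toStage13Params p j)) j)
    (hε : ∀ j, 1 ≤ j → j ≤ k + 1 → 0 < epsOfRecord θ.ν (gOfRecord₁₃ F N θ.toStage13Params p) j)
    (hε3 : ∀ j, 1 ≤ j → j ≤ k + 1 → (143 * (((((F.P p.K).d + 4 : ℕ) : ℝ)) ^ 2 / 4) ^ 2) * epsOfRecord θ.ν (gOfRecord₁₃ F N θ.toStage13Params p) j ≤ 1 / 3)
    (hε2 : ∀ j, 1 ≤ j → j ≤ k + 1 →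
      2 * epsOfRecord θ.ν (gOfRecord₁₃ F N θ.toStage13Params p) j ≤ 2 * ExpMeanLog.deltaSU (Fin N) / ((((F.P p.K).d + 4) * (F.P p.K).L : ℕ) : ℝ) ^ 2)
    (hsolv : ∀ j, 1 ≤ j → j ≤ k + 1 → ∀ (s : SeqOfRecord F θ.ν θ.τ9.M (gOfRecord₁₃ F N θ.toStage13Params p) p.K j) (V : GaugeField (F.P p.K) j (SU N)),
      chiSeqOfRecord F N θ.ν θ.τ9.M (gOfRecord₁₃ F N θ.toStage13Params p) p.K j s V ≠ 0 →
      ∀ a ∈ cubesIn (fun a : ↥(cubeIndices (F.P p.K) (cubeSide (F.P p.K).L θ.ν.M₂ (RkOfRecord (F.P p.K).L θ.ν.r (gOfRecord₁₃ F N θ.toStage13Params p j)) j)) =>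
          cubeEnl (F.P p.K) (cubeSide (F.P p.K).L θ.ν.M₂ (RkOfRecord (F.P p.K).L θ.ν.r (gOfRecord₁₃ F N θ.toStage13Params p j)) j) a 0) (s.Ω j),
        ∃ U₀, IsMinimizer (avOfRecord F N p.K) {U | PlaqSmall (θ.ν.εreg * (F.P p.K).eta j ^ 2) U}
          (Bj θ.ν.M₁ (cubeEnl (F.P p.K) (cubeSide (F.P p.K).L θ.ν.M₂ (RkOfRecord (F.P p.K).L θ.ν.r (gOfRecord₁₃ F N θ.toStage13Params p j)) j) a 4) j)
          (avgFamily (avOfRecord F N p.K) (qsstarGIter0 j V)) U₀)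
    (hcov : ∀ j, 1 ≤ j → j ≤ k + 1 → ∀ s : SeqOfRecord F θ.ν θ.τ9.M (gOfRecord₁₃ F N θ.toStage13Params p) p.K j,
      s.Ω j ⊆ ⋃ a ∈ cubesIn (fun a : ↥(cubeIndices (F.P p.K) (cubeSide (F.P p.K).L θ.ν.M₂ (RkOfRecord (F.P p.K).L θ.ν.r (gOfRecord₁₃ F N θ.toStage13Params p j)) j)) =>
          cubeEnl (F.P p.K) (cubeSide (F.P p.K).L θ.ν.M₂ (RkOfRecord (F.P p.K).L θ.ν.r (gOfRecord₁₃ F N θ.toStage13Params p j)) j) a 0) (s.Ω j),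
        cubeEnl (F.P p.K) (cubeSide (F.P p.K).L θ.ν.M₂ (RkOfRecord (F.P p.K).L θ.ν.r (gOfRecord₁₃ F N θ.toStage13Params p j)) j) a 0)
    (t₀ : SeqOfRecord F θ.ν θ.τ9.M (gOfRecord₁₃ F N θ.toStage13Params p) p.K k → Sect2.TermValues (F.P p.K) (MatA N) (FluctV N) θ.τ9.M)
    (E₀ : SeqOfRecord F θ.ν θ.τ9.M (gOfRecord₁₃ F N θ.toStage13Params p) p.K k → ℝ)
    (hform₀ : HasSect2FormAtZS F N (FluctV N) p.K (settingOfRecord₁₃ F N θ.toStage13Params p) k (θ.rzAt p) (WtOfRecord₁₃H F N θ p)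
      (UbgOfRecord₁₃CoP F N θ.toStage13Params p k)
      (fun s₀ t' => Sect2.LawsRT (sect2TowerOfRecord F N (FluctV N) p.K (settingOfRecord₁₃ F N θ.toStage13Params p) (θ.rzAt p s₀) s₀ t')
        (settingOfRecord₁₃ F N θ.toStage13Params p).lf k)
      (slotsOfRecord F N θ.ν θ.τ9 (EOfRecord₁₃ F N θ.toStage13Params) (wOfRecord₉ F N θ.toStage9Params) θ.ppSel p (gOfRecord₁₃ F N θ.toStage13Params p) k) t₀ E₀)
    (hBt : ∀ s₀ (S' : ℕ → Set (Site (F.P p.K) 0)) (j : ℕ) (X : (Sect2.domSys (F.P p.K) θ.τ9.M j).Dom), 1 ≤ j → j ≤ k →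
      Measurable (fun q : GaugeField (F.P p.K) 0 (SU N) × MSFluct (F.P p.K) (FluctV N) =>
        (t₀ s₀).B j X (Sect2.ofBackgroundC (settingOfRecord₁₃ F N θ.toStage13Params p).ι q.1) (S', q.2)))
    :
    ∀ (s : SeqOfRecord F θ.ν θ.τ9.M (gOfRecord₁₃ F N θ.toStage13Params p) p.K (k + 1)), s.Ω (k + 1) = ∅ →
        -- (P) prefix agreement below `k`
        (∀ j, j < k → (θ.zhAt p s).ζ0 j = (θ.zhAt p s.init).ζ0 j ∧ (θ.zhAt p s).quad j = (θ.zhAt p s.init).quad j) →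
        -- (V) the generation-`k` pin with the old front factor
        (∀ (V' : GaugeField (F.P p.K) (k + 1) (SU N)) (U₀ : GaugeField (F.P p.K) k (SU N)),
          (θ.zhAt p s).ζ0 k Set.univ (pairCfgAt (V := FluctV N) k V' U₀) =
            chiSeqOfRecord F N θ.ν θ.τ9.M (gOfRecord₁₃ F N θ.toStage13Params p) p.K k s.init U₀ *
              wOfRecord₉ F N θ.toStage9Params p (gOfRecord₁₃ F N θ.toStage13Params p) k s U₀ ((avOfRecord F N p.K k).avg U₀)) →
        -- `quad_k(∅) = 0` on the two-scale configurations
        (∀ (V' : GaugeField (F.P p.K) (k + 1) (SU N)) (U₀ : GaugeField (F.P p.K) k (SU N)), (θ.zhAt p s).quad k ∅ (pairCfgAt (V := FluctV N) k V' U₀) = 0) →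
        -- `k`-locality of `quad_j(Λ_{j+1})`, `j < k`
        (∀ j, j < k → ∀ ω ω' : MultiCfg (F.P p.K) (SU N) (FluctV N), (∀ i, i ≤ k → ω i = ω' i) →
          (θ.zhAt p s).quad j (s.init.Λ (j + 1)) ω = (θ.zhAt p s).quad j (s.init.Λ (j + 1)) ω') →
        -- measurability of the residual serving `s′`
        (∀ j (Y : Set (Site (F.P p.K) 0)), Measurable ((θ.zhAt p s).ζ0 j Y)) →
        (∀ j (Λ' : Set (Site (F.P p.K) 0)), Measurable ((θ.zhAt p s).quad j Λ')) →
        -- per old branch: A-fibre domination (K0b)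
        (∀ S ∈ admSOfRecord F θ.ν θ.τ9.M (gOfRecord₁₃ F N θ.toStage13Params p) p.K k s.init, ∀ j : ℕ,
          ∃ ŵ : (↥(Set.toFinite (B10Eq42TorusConstraint.bondsIn j ((s.init.Λ (j + 1))ᶜ ∩ s.init.Ω (j + 1)))).toFinset → FluctV N) → ℝ≥0∞, Measurable ŵ ∧
            (∫⁻ a, ŵ a ∂(Measure.pi fun _ : ↥(Set.toFinite (B10Eq42TorusConstraint.bondsIn j ((s.init.Λ (j + 1))ᶜ ∩ s.init.Ω (j + 1)))).toFinset => (volume : Measure (FluctV N)))) ≠ ⊤ ∧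
            ∀ ω, ENNReal.ofReal ((WtOfRecord₁₃H F N θ p s).w j (s.init.Λ (j + 1)) ((s.init.Λ (j + 1))ᶜ ∩ s.init.Ω (j + 1)) (S (j + 1)) ω) ≤
              ŵ (fun b : ↥(Set.toFinite (B10Eq42TorusConstraint.bondsIn j ((s.init.Λ (j + 1))ᶜ ∩ s.init.Ω (j + 1)))).toFinset => (ω j).2 b)) →
        (slotsTOfRecord F N θ.ν θ.τ9 (EOfRecord₁₃ F N θ.toStage13Params) (wOfRecord₉ F N θ.toStage9Params) θ.ppSel p
            (gOfRecord₁₃ F N θ.toStage13Params p) (k + 1) s = 0 ∨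
          ∀ᵐ V' ∂fieldMeasure (F.P p.K) (k + 1) (SU N),
            chiSeqOfRecord F N θ.ν θ.τ9.M (gOfRecord₁₃ F N θ.toStage13Params p) p.K (k + 1) s V' ≠ 0 →
              slotsTOfRecord F N θ.ν θ.τ9 (EOfRecord₁₃ F N θ.toStage13Params) (wOfRecord₉ F N θ.toStage9Params) θ.ppSel p
                  (gOfRecord₁₃ F N θ.toStage13Params p) (k + 1) s V' =
                sect2Slot F N (FluctV N) p.K (settingOfRecord₁₃ F N θ.toStage13Params p) (θ.rzAt p s) (WtOfRecord₁₃H F N θ p s) s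
                  (t₀ s.init) (E₀ s.init) (UbgOfRecord₁₃CoP F N θ.toStage13Params p (k + 1) s) V') := by
  -- the rows restricted to the parent levels `≤ k`
  have hkm₀ : k ≤ (F.P p.K).m + (F.P p.K).K := (Nat.le_succ k).trans hkm
  refine clause_succ_sameWitness_of_hasSect2FormAtZS_of_borelB_of_bgReadChargedFibre θ p h.toCore (zhUnity_of_gaussCert θ hζ0) hθ hpos hk hM hw θ.s2.cR
    (fun s₀ j Y => {x | (j < k ∧ Y = (s₀.Ω (j + 1))ᶜ) ∧ x ∈ readSelOfSeq F p (suppDomOfRecord F θ.ν p.K s₀.Ω) s₀.Ω j Y})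
    (fun s₀ => regOn_cutSel_of_zhPin_of_solvable θ p hζ0 hk.le hkm₀ hcR hM₁ (fun j h1 hj => h3 j h1 (Nat.le_succ_of_le hj))
      (fun j h1 hj => hR j h1 (Nat.le_succ_of_le hj)) (fun j h1 hj => hε j h1 (Nat.le_succ_of_le hj)) (fun j h1 hj => hε3 j h1 (Nat.le_succ_of_le hj))
      (fun j h1 hj => hε2 j h1 (Nat.le_succ_of_le hj)) (fun j h1 hj => hsolv j h1 (Nat.le_succ_of_le hj)) (fun j h1 hj => hcov j h1 (Nat.le_succ_of_le hj)) s₀)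
    (bgProvisoΛ_chargedFibre_of_sep_of_junctionFibre θ p hM₁ hle θ.s2.cR (fun s₀ j Y => {x | (j < k ∧ Y = (s₀.Ω (j + 1))ᶜ) ∧ x ∈ readSelOfSeq F p (suppDomOfRecord F θ.ν p.K s₀.Ω) s₀.Ω j Y}) (h.bg p k hk.le hw hPC)
      fun s₀ hch hs Wc hχ hlow => sepJunctionChargedFibre_of_solvable θ p hk1 hkm₀ hcR hM₁ (h3 k hk1 (Nat.le_succ k)) (hR k hk1 (Nat.le_succ k))
        (hε k hk1 (Nat.le_succ k)) (hε3 k hk1 (Nat.le_succ k)) (hε2 k hk1 (Nat.le_succ k))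
        (fun s₁ _ _ Wc₁ hχ₁ => hsolv k hk1 (Nat.le_succ k) s₁ (Wc₁ k) hχ₁) (fun s₁ => hcov k hk1 (Nat.le_succ k) s₁) s₀ hch hs Wc hχ
        fun j hj => by have h' := hlow j hj; beta_reduce at h'; rw [sep_setOf_eq_of (And.intro hj rfl)] at h'; exact h')
    t₀ E₀ hform₀ hBt
    (fun s₀ j Y => {x | (j < k + 1 ∧ Y = (s₀.Ω (j + 1))ᶜ) ∧ x ∈ readSelOfSeq F p (suppDomOfRecord F θ.ν p.K s₀.Ω) s₀.Ω j Y})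
    (fun s => regOn_cutSel_of_zhPin_of_solvable θ p hζ0 hk hkm hcR hM₁ h3 hR hε hε3 hε2 hsolv hcov s)
    fun s Wc hWc j h1 hj X => ?_
  -- the child-level proviso: record row `bg` at level `k+1` + the charge-free fibre junction at level `k+1` (T-charged child ⇒ separated)
  have hs : Sect2.SeqSeparated θ.ν.M₁ s := seqSeparated_of_slotsTOfRecord₁₃_succ_ne_zero_of_M₁_le_M θ p hM₁ hle s hWc.1
  refine h.bg p (k + 1) hk hw' hPC' s Wc ?_ j h1 (Nat.le_succ_of_le hj) X
  refine mem_suppOfRecord₁₃SepCoP_of_sep_of_top_of_fibre θ p (Nat.succ_pos k) hM₁ s hs Wc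
    (fun j' hj' => by have h' := hWc.2.2.1 j' hj'; beta_reduce at h'; rw [sep_setOf_eq_of (And.intro hj' rfl)] at h'; exact h') ?_ hWc.2.2.2.2
  have h2 := plaqSmallOn_genSet_top_of_chiSeqOfRecord_ne_zero_of_solvable (F := F) (N := N) θ.ν θ.τ9.M (gOfRecord₁₃ F N θ.toStage13Params p) p.K (k + 1)
    hkm s (Wc (k + 1)) hWc.2.1 hM₁ (h3 (k + 1) (Nat.succ_pos k) le_rfl) (hR (k + 1) (Nat.succ_pos k) le_rfl) (hε (k + 1) (Nat.succ_pos k) le_rfl)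
    (hε3 (k + 1) (Nat.succ_pos k) le_rfl) (hε2 (k + 1) (Nat.succ_pos k) le_rfl) (hsolv (k + 1) (Nat.succ_pos k) le_rfl s (Wc (k + 1)) hWc.2.1)
    (hcov (k + 1) (Nat.succ_pos k) le_rfl s)
  exact fun q hq => (h2 q hq).trans_le (mul_le_mul_of_nonneg_right hcR (hε (k + 1) (Nat.succ_pos k) le_rfl).le)

end Summit.QuantumFields.YangMills.Theorems.BalabanUVNodesN11SameWitnessZhPinOfSolvable

end
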